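import Literature.AlgebraicGeometry.Resolution.WeightedBlowupShade

/-!
# The transplanted weighted step never increases the second entry (pub-rosobs observatory, Lemma NI)

The resolution observatory (`pub-rosobs`, PATTERNS C13) recorded, at every equimultiple `𝔽_p`-point of
every weighted (cobordant) step it computed (> 10⁵ points, three independent implementations), that the
second entry `ord₀ F_clean` of the transplanted invariant never increases.  This file PROVES it for the
objects of `WeightedBlowupShade` (derived here, elementary):

* `coeff_translate_monomial` — Taylor coefficients of a translated monomial,
  `coeff D ((u + b)^E) = ∏ᵢ C(Eᵢ, Dᵢ) bᵢ^{Eᵢ − Dᵢ}`;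
* `coeff_pointPolynomial_mapDomain_some` — if `F` has order `n`, the coordinate centre with cocharacter
  `γ` is admissible for `F` with exponents `cᵢ = 1/γᵢ ≥ n` (`γᵢ·n ≤ 1`), the weights are `wᵢ = ℓγᵢ`
  (`ℓ > 0`) and the point `b` lies on the exceptional divisor over the origin (`b none = 0`, `bᵢ = 0` off
  the centre variables), then every initial monomial `u^α` of `F` (`|α| = n`) appears in
  `F'(s, u' + b)` with the SAME coefficient: it lies on the face `v_J = 1` (so carries no power of `s`), and
  any other monomial of `F'` that could produce `u'^α` under the translation would be `≥ α` on the centre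
  variables with the same `s`-exponent `0`, forcing equality;
* `not_secondEntryIncreases` — consequently, for `F` cleaned (`deletePthPowers q F = F`),
  `¬ SecondEntryIncreases q w ℓ b F`: `ord₀ clean_q(F'(s,u'+b) − F'(0,b)) ≤ ord₀ F`.

Scope (honest): points over the ORIGIN of the centre, coordinate centres (observatory convention FW2),
any `q`, any dimension, any commutative ring of coefficients.  Nothing is said about the other entries of
the invariant.  Published ingredients: the cobordant presentation of the weighted blow-up
[AbramovichQuekSchober2025, Def. 4.5], admissibility via the monomial valuation
[AbramovichTemkinWlodarczyk2024, §5.1], cleaning [Hauser2010, §G]. [folklore]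
-/

open MvPolynomial Finset

open scoped BigOperators

namespace Literature.AlgebraicGeometry.Resolution

open Literature.AlgebraicGeometry.Resolution.Hauser2010

noncomputable section

namespace WeightedBlowup

/-! ## 1. Taylor coefficients of translated monomials -/

section Translate

variable {τ : Type*} {K : Type*} [CommRing K] [Fintype τ] [DecidableEq τ]

/-- `coeff β (∏ᵢ (Xᵢ + C cᵢ)^{dᵢ}) = ∏ᵢ C(dᵢ, βᵢ)·cᵢ^{dᵢ − βᵢ}` (finite index type). [folklore] -/
theorem coeff_prod_X_add_C_pow (c : τ → K) (d : τ → ℕ) (β : τ →₀ ℕ) :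
    MvPolynomial.coeff β (∏ i, (X i + C (c i) : MvPolynomial τ K) ^ (d i)) =
      ∏ i, (((d i).choose (β i) : K) * c i ^ (d i - β i)) := by
  classical
  have hfac : ∀ i, (X i + C (c i) : MvPolynomial τ K) ^ (d i) =
      ∑ l ∈ Finset.range (d i + 1), C (((d i).choose l : K) * c i ^ (d i - l)) * X i ^ l := by
    intro i
    rw [add_pow]
    refine Finset.sum_congr rfl fun l _ => ?_
    simp only [map_mul, map_natCast, map_pow]
    ring
  simp_rw [hfac]
  rw [Finset.prod_univ_sum, MvPolynomial.coeff_sum]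
  have hterm : ∀ L : τ → ℕ,
      (∏ i, C (((d i).choose (L i) : K) * c i ^ (d i - L i)) * X i ^ (L i) : MvPolynomial τ K) =
        monomial (Finsupp.equivFunOnFinite.symm L) (∏ i, (((d i).choose (L i) : K) * c i ^ (d i - L i))) := by
    intro L
    rw [Finset.prod_mul_distrib, ← map_prod, MvPolynomial.monomial_eq, Finsupp.prod_pow]
    simp
  simp_rw [hterm, MvPolynomial.coeff_monomial]
  rw [Finset.sum_eq_single (⇑β)]
  · simp
  · intro L _ hL
    rw [if_neg]
    intro h
    apply hL
    rw [← h]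
    simp
  · intro hβ
    rw [if_pos (by simp)]
    rw [Fintype.mem_piFinset] at hβ
    push Not at hβ
    obtain ⟨i, hi⟩ := hβ
    rw [Finset.mem_range, not_lt] at hi
    apply Finset.prod_eq_zero (Finset.mem_univ i)
    rw [Nat.choose_eq_zero_of_lt (by omega), Nat.cast_zero, zero_mul]

omit [DecidableEq τ] in
/-- Translation of a monomial: `translate b (a·u^E) = a · ∏ᵢ (uᵢ + bᵢ)^{Eᵢ}`. [folklore] -/
theorem translate_monomial (b : τ → K) (E : τ →₀ ℕ) (a : K) :
    PointBlowup.translate b (monomial E a) = C a * ∏ i, (X i + C (b i) : MvPolynomial τ K) ^ (E i) := by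
  unfold PointBlowup.translate
  rw [MvPolynomial.aeval_monomial, Finsupp.prod_fintype _ _ (fun i => pow_zero _)]
  simp [MvPolynomial.algebraMap_eq]

/-- **Taylor coefficients of a translated monomial**:
`coeff D (translate b (a·u^E)) = a · ∏ᵢ C(Eᵢ, Dᵢ)·bᵢ^{Eᵢ − Dᵢ}`. [folklore] -/
theorem coeff_translate_monomial (b : τ → K) (E D : τ →₀ ℕ) (a : K) :
    coeff D (PointBlowup.translate b (monomial E a)) =
      a * ∏ i, (((E i).choose (D i) : K) * b i ^ (E i - D i)) := by
  rw [translate_monomial, MvPolynomial.coeff_C_mul, coeff_prod_X_add_C_pow]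

/-- The top coefficient is unchanged by translation: `coeff E (translate b (a·u^E)) = a`. [folklore] -/
theorem coeff_translate_monomial_self (b : τ → K) (E : τ →₀ ℕ) (a : K) :
    coeff E (PointBlowup.translate b (monomial E a)) = a := by
  rw [coeff_translate_monomial]
  simp

/-- A translated monomial `(u + b)^E` produces `u^D` only if `D ≤ E` … [folklore] -/
theorem coeff_translate_monomial_eq_zero_of_lt (b : τ → K) (E D : τ →₀ ℕ) (a : K) {i : τ}
    (h : E i < D i) : coeff D (PointBlowup.translate b (monomial E a)) = 0 := by
  rw [coeff_translate_monomial]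
  have : (((E i).choose (D i) : K) * b i ^ (E i - D i)) = 0 := by
    rw [Nat.choose_eq_zero_of_lt h, Nat.cast_zero, zero_mul]
  rw [Finset.prod_eq_zero (Finset.mem_univ i) this, mul_zero]

/-- … and with `Dᵢ = Eᵢ` at every UNtranslated variable (`bᵢ = 0`). [folklore] -/
theorem coeff_translate_monomial_eq_zero_of_apply_eq_zero (b : τ → K) (E D : τ →₀ ℕ) (a : K) {i : τ}
    (hb : b i = 0) (h : D i < E i) : coeff D (PointBlowup.translate b (monomial E a)) = 0 := by
  rw [coeff_translate_monomial]
  have : (((E i).choose (D i) : K) * b i ^ (E i - D i)) = 0 := by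
    rw [hb, zero_pow (by omega), mul_zero]
  rw [Finset.prod_eq_zero (Finset.mem_univ i) this, mul_zero]

end Translate

/-! ## 2. The initial monomials survive the weighted step -/

section Initial

variable {σ : Type*} {K : Type*} [CommRing K] [Fintype σ] [DecidableEq σ]

omit [DecidableEq σ] in
/-- The exceptional exponent of the cobordant transform of `u^d`: `(Σ wᵢdᵢ) − ℓ`. [folklore] -/
theorem cobordantExponent_none (w : σ → ℕ) (ℓ : ℕ) (d : σ →₀ ℕ) :
    cobordantExponent w ℓ d none = (∑ i, w i * d i) - ℓ := by
  unfold cobordantExponent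
  rw [Finsupp.add_apply, Finsupp.mapDomain_notin_range _ _ (by simp), Finsupp.single_eq_same,
    Finsupp.sum_fintype _ _ (fun i => by simp), zero_add]

omit [Fintype σ] [DecidableEq σ] in
/-- The `u'`-exponents of the cobordant transform of `u^d` are those of `u^d`. [folklore] -/
theorem cobordantExponent_some (w : σ → ℕ) (ℓ : ℕ) (d : σ →₀ ℕ) (i : σ) :
    cobordantExponent w ℓ d (some i) = d i := by
  unfold cobordantExponent
  rw [Finsupp.add_apply, Finsupp.mapDomain_apply (Option.some_injective σ), Finsupp.single_apply,
    if_neg (by simp), add_zero]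

omit [Fintype σ] [DecidableEq σ] in
/-- `(d.mapDomain some) none = 0`. [folklore] -/
theorem mapDomain_some_none (d : σ →₀ ℕ) : d.mapDomain some none = 0 :=
  Finsupp.mapDomain_notin_range _ _ (by simp)

omit [Fintype σ] [DecidableEq σ] in
/-- `(d.mapDomain some) (some i) = d i`. [folklore] -/
theorem mapDomain_some_some (d : σ →₀ ℕ) (i : σ) : d.mapDomain some (some i) = d i :=
  Finsupp.mapDomain_apply (Option.some_injective σ) _ _

omit [Fintype σ] [DecidableEq σ] in
/-- `mapDomain some` preserves the degree. [folklore] -/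
theorem degree_mapDomain_some (d : σ →₀ ℕ) : (d.mapDomain some).degree = d.degree := by
  classical
  simp only [Finsupp.degree, AddMonoidHom.coe_mk, ZeroHom.coe_mk]
  rw [Finsupp.mapDomain_support_of_injective (Option.some_injective σ),
    Finset.sum_image (fun x _ y _ h => Option.some_injective σ h)]
  exact Finset.sum_congr rfl fun i _ => Finsupp.mapDomain_apply (Option.some_injective σ) _ _

omit [DecidableEq σ] in
/-- **An initial monomial lies on the face `v_J = 1`** and its weighted degree is `ℓ`:
if `1 ≤ v_γ(α)` (admissibility), `γᵢ·|α| ≤ 1` for all `i`, and `wᵢ = ℓγᵢ` (natural numbers, so `γ ≥ 0`), then `Σ wᵢαᵢ = ℓ`.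
(derived here) [folklore] -/
theorem weightedDegree_eq_of_initial (γ : σ → ℚ) (w : σ → ℕ) (ℓ : ℕ) (α : σ →₀ ℕ)
    (hadm : 1 ≤ monomialValuation γ α) (hγn : ∀ i, γ i * α.degree ≤ 1)
    (hw : ∀ i, (w i : ℚ) = ℓ * γ i) : ∑ i, w i * α i = ℓ := by
  classical
  -- the valuation as a finite sum
  have hval : monomialValuation γ α = ∑ i, (α i : ℚ) * γ i := by
    unfold monomialValuation
    rw [Finsupp.sum_fintype _ _ (fun i => by simp)]
  have hdegN : α.degree = ∑ i, α i := by
    simp only [Finsupp.degree, AddMonoidHom.coe_mk, ZeroHom.coe_mk]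
    exact Finset.sum_subset (Finset.subset_univ _) (fun i _ hi => Finsupp.notMem_support_iff.mp hi)
  have hdeg : (α.degree : ℚ) = ∑ i, (α i : ℚ) := by
    rw [hdegN]; push_cast; rfl
  -- α ≠ 0, so its degree is positive
  have hαne : α ≠ 0 := by
    rintro rfl
    norm_num [monomialValuation] at hadm
  have hdegpos : 0 < α.degree := by
    rw [pos_iff_ne_zero, Ne, Finsupp.degree_eq_zero_iff]
    exact hαne
  -- v(α) ≤ 1
  have hle : monomialValuation γ α ≤ 1 := by
    rw [hval]
    have h1 : (∑ i, (α i : ℚ) * γ i) * α.degree ≤ ∑ i, (α i : ℚ) := by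
      rw [Finset.sum_mul]
      refine Finset.sum_le_sum fun i _ => ?_
      have := hγn i
      have hαi : (0 : ℚ) ≤ α i := by positivity
      nlinarith
    rw [← hdeg] at h1
    have hd : (0 : ℚ) < α.degree := by exact_mod_cast hdegpos
    by_contra hgt
    push Not at hgt
    nlinarith
  have hv1 : monomialValuation γ α = 1 := le_antisymm hle hadm
  -- Σ w α = ℓ · v(α) = ℓ
  have hq : ((∑ i, w i * α i : ℕ) : ℚ) = ℓ := by
    push_cast
    simp_rw [hw]
    rw [hval] at hv1
    calc ∑ i, (ℓ : ℚ) * γ i * (α i : ℚ) = ℓ * ∑ i, (α i : ℚ) * γ i := by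
            rw [Finset.mul_sum]; exact Finset.sum_congr rfl fun i _ => by ring
      _ = ℓ := by rw [hv1, mul_one]
  exact_mod_cast hq

/-- **The initial monomials survive the weighted step with their coefficients** (see the module
docstring for the hypotheses). (derived here) [folklore] -/
theorem coeff_pointPolynomial_mapDomain_some (γ : σ → ℚ) (w : σ → ℕ) (ℓ : ℕ)
    (b : Option σ → K) (F : MvPolynomial σ K) (α : σ →₀ ℕ) (n : ℕ)
    (hadm : IsAdmissibleFor γ F) (hγn : ∀ i, γ i * n ≤ 1)
    (hw : ∀ i, (w i : ℚ) = ℓ * γ i) (hℓ : 0 < ℓ)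
    (hb0 : b none = 0) (hbS : ∀ i, γ i = 0 → b (some i) = 0)
    (hα : coeff α F ≠ 0) (hαn : α.degree = n) :
    coeff (α.mapDomain some) (pointPolynomial w ℓ b F) = coeff α F := by
  classical
  have hαsupp : α ∈ F.support := by simpa [MvPolynomial.mem_support_iff] using hα
  have hwα : ∑ i, w i * α i = ℓ :=
    weightedDegree_eq_of_initial γ w ℓ α (hadm α hαsupp) (by rw [hαn]; exact hγn) hw
  -- the cobordant exponent of α is α itself (no power of s)
  have hEα : cobordantExponent w ℓ α = α.mapDomain some := by
    unfold cobordantExponent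
    rw [Finsupp.sum_fintype _ _ (fun i => by simp), hwα, Nat.sub_self, Finsupp.single_zero, add_zero]
  unfold pointPolynomial cobordantTransform
  unfold PointBlowup.translate
  rw [map_sum, coeff_sum]
  change ∑ x ∈ F.support, coeff (α.mapDomain some)
      (PointBlowup.translate b (monomial (cobordantExponent w ℓ x) (coeff x F))) = coeff α F
  rw [Finset.sum_eq_single α]
  · rw [hEα, coeff_translate_monomial_self]
  · intro β hβ hβα
    -- a monomial β ≠ α of F cannot produce u'^α
    set E := cobordantExponent w ℓ β with hE
    set D := α.mapDomain some with hD
    by_cases h1 : ∃ i, E i < D i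
    · obtain ⟨i, hi⟩ := h1
      exact coeff_translate_monomial_eq_zero_of_lt b E D _ hi
    by_cases h2 : ∃ i, b i = 0 ∧ D i < E i
    · obtain ⟨i, hbi, hi⟩ := h2
      exact coeff_translate_monomial_eq_zero_of_apply_eq_zero b E D _ hbi hi
    exfalso
    push Not at h1 h2
    -- from h1 at `some i`: α ≤ β; from h2 at `none`: Σ w β ≤ ℓ
    have hle : ∀ i, α i ≤ β i := fun i => by
      have := h1 (some i)
      rwa [hE, cobordantExponent_some, hD, mapDomain_some_some] at this
    have hnone : (∑ i, w i * β i) - ℓ ≤ 0 := by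
      have := h2 none hb0
      rwa [hE, cobordantExponent_none, hD, mapDomain_some_none] at this
    have hwβ : ∑ i, w i * β i ≤ ℓ := by omega
    -- hence Σ w β = Σ w α and β = α on the centre variables; off them by hbS
    have hsum : ∑ i, w i * β i = ∑ i, w i * α i := by
      apply le_antisymm (hwα ▸ hwβ)
      exact Finset.sum_le_sum fun i _ => Nat.mul_le_mul_left _ (hle i)
    have hterm : ∀ i, w i * β i = w i * α i := by
      have hge : ∀ i ∈ (Finset.univ : Finset σ), w i * α i ≤ w i * β i :=
        fun i _ => Nat.mul_le_mul_left _ (hle i)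
      intro i
      exact ((Finset.sum_eq_sum_iff_of_le hge).mp hsum.symm i (Finset.mem_univ i)).symm
    apply hβα
    ext i
    by_cases hwi : w i = 0
    · have hγi : γ i = 0 := by
        have := hw i
        rw [hwi, Nat.cast_zero] at this
        have hℓq : (ℓ : ℚ) ≠ 0 := by exact_mod_cast hℓ.ne'
        exact (mul_eq_zero.mp this.symm).resolve_left hℓq
      have := h2 (some i) (hbS i hγi)
      rw [hE, cobordantExponent_some, hD, mapDomain_some_some] at this
      exact le_antisymm this (hle i)
    · have := hterm i
      exact (Nat.eq_of_mul_eq_mul_left (Nat.pos_of_ne_zero hwi) this)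
  · intro h
    exact absurd hαsupp h

/-! ## 3. No increase of the second entry -/

/-- **Lemma NI (no weighted kangaroo for the pair).** For `F` cleaned of `q`-th powers, of order `n`,
a cocharacter `γ` admissible for `F` with `γᵢ·n ≤ 1` (centre exponents `≥ ord F`; the
transplanted centre has `c₁ = ord F`), weights `wᵢ = ℓγᵢ`, `ℓ > 0`, and a point `b` of the exceptional
divisor over the origin (`b none = 0`, `bᵢ = 0` off the centre variables), the second entry does not
increase: `¬ SecondEntryIncreases q w ℓ b F`. (derived here: the observatory's PATTERNS C13, now proved) [folklore] -/
theorem not_secondEntryIncreases (q : ℕ) (γ : σ → ℚ) (w : σ → ℕ) (ℓ : ℕ)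
    (b : Option σ → K) (F : MvPolynomial σ K) (n : ℕ)
    (hF : deletePthPowers q F = F) (hn : ordZero F = n)
    (hadm : IsAdmissibleFor γ F) (hγn : ∀ i, γ i * n ≤ 1)
    (hw : ∀ i, (w i : ℚ) = ℓ * γ i) (hℓ : 0 < ℓ)
    (hb0 : b none = 0) (hbS : ∀ i, γ i = 0 → b (some i) = 0) :
    ¬ SecondEntryIncreases q w ℓ b F := by
  classical
  intro hinc
  unfold SecondEntryIncreases at hinc
  rw [hF, hn] at hinc
  obtain ⟨⟨α, hα, hαn⟩, -⟩ := (ordZero_eq_nat_iff F n).mp hn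
  have hαsupp : α ∈ F.support := by simpa [MvPolynomial.mem_support_iff] using hα
  -- α is not a q-th power exponent (F is cleaned), hence neither is α.mapDomain some
  have hnotp : ¬ IsPthPowerExponent q α := by
    intro hp
    apply hα
    rw [← hF, coeff_deletePthPowers, if_pos hp]
  have hnotpD : ¬ IsPthPowerExponent q (α.mapDomain some) := by
    intro hp
    apply hnotp
    rw [isPthPowerExponent_iff] at hp ⊢
    intro i
    simpa [mapDomain_some_some] using hp (some i)
  -- α ≠ 0 by admissibility
  have hαne : α ≠ 0 := by
    rintro rfl
    have := hadm 0 hαsupp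
    norm_num [monomialValuation] at this
  have hDne : α.mapDomain some ≠ 0 := by
    intro h
    apply hαne
    ext i
    have := congrArg (fun f => f (some i)) h
    simpa [mapDomain_some_some] using this
  -- the coefficient of u'^α in the new residual is coeff α F ≠ 0
  have hkey := coeff_pointPolynomial_mapDomain_some γ w ℓ b F α n hadm hγn hw hℓ hb0 hbS hα hαn
  have hcoeff : coeff (α.mapDomain some) (newResidual q w ℓ b F) = coeff α F := by
    unfold newResidual residual
    rw [coeff_deletePthPowers, if_neg hnotpD, coeff_sub, coeff_C, if_neg (Ne.symm hDne), sub_zero, hkey]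
  -- so its order is at most |α| = n
  have hle : ordZero (newResidual q w ℓ b F) ≤ n := by
    have h := hcoeff ▸ hα
    unfold ordZero
    by_contra hlt
    have hlt' : ((α.mapDomain some).degree : ℕ∞) < ((newResidual q w ℓ b F : MvPolynomial (Option σ) K) :
        MvPowerSeries (Option σ) K).order := by
      rw [degree_mapDomain_some, hαn]; exact not_le.mp hlt
    have := MvPowerSeries.coeff_of_lt_order hlt'
    rw [MvPolynomial.coeff_coe] at this
    exact h this
  exact absurd (lt_of_lt_of_le hinc hle) (lt_irrefl _)

end Initial

end WeightedBlowup

end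

end Literature.AlgebraicGeometry.Resolution
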